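import Summits.BirchSwinnertonDyer.BirchSwinnertonDyer.Theorems.Rank1ResidualJetSection6
import Summits.BirchSwinnertonDyer.BirchSwinnertonDyer.Theorems.Rank1ResidualJetDefs
import Literature.NumberTheory.EllipticCurves.McCallum1991.HigherLevelKolyvaginClasses
import HarnessLib

/-!
# T1 JET (cell `bsd-jet`), road K: the BRIDGE from the abstract §6 kernel (`Rank1ResidualJetSection6`)
# to the reading binders' ROW CURRENCY — Kolyvagin's `m_∞` built from McCallum 1991 Prop. 5.2, and
# `K1`/`K3`/`K4` reduced to «Prop. 6.4 + Thm. 6.3 instantiated»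

HONEST FRAMING (programme file §HONESTY, verbatim): «no tranche here proves BSD; ARM L moves the
LITERAL column of an r ≤ 1 census into the kernel-proved-modulo-named-print column; ARM P changes
what «named print» is worth.» THEOREMS ONLY (seat `bsd-jet-pv-2`, session g2;
`--supports stmt-BirchSwinnertonDyer-14418`, helper). Nothing here books a class; the three reading
binders `JET.JetchevDivisibilityCarrierNe` (K1), `…CarrierMult` (K3), `…CarrierAdd` (K4) stay
`@[conjecture]`; this file proves IMPLICATIONS into them.

WHAT IS PROVED. `Rank1ResidualJetSection6.lean` (p471669) proved Jetchev's §6 over ABSTRACT data: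
a type `Λ` of conductors with `M, m', m : Λ → ℕ∞`, a number `m_∞` with `hmInf : m_∞ ≤ m(c)` and
Kolyvagin's redefinition `hK : ∀ m', ∃ c, m' ≤ M(c) ∧ m(c) = m_∞`, a predicate `Core`, Prop. 6.4 (`h64`)
and Thm. 6.3 (`h63`) ⟹ `s ≤ m'(c)` for `s ≤ t`, `s ≤ M(c)` (`depth_le_mdiv_of_coreVertices`). Here:

* `derivedPoint_divisible_of_prop52_of_section6` — the SAME conclusion in the binders' currency
  (`KolyvaginHeegnerData Dt β ι n`, `d.derivedPoint ∈ E(K[n])`, `Zhang2014.IsKolyvaginPrime`,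
  `Zhang2014.kolyvaginIndex`, `Zhang2014.levelIndex`), with `Λ` := square-free products of Kolyvagin
  primes, `M(c) := Zhang2014.levelIndex W p c`, `m'(c)` := the `p`-divisibility depth of the derived
  points of conductor `c` (characterised, not defined: `(u : ℕ∞) ≤ m'(c) ↔ ∀ d, ∃ Q, p^u Q = P_c(d)`),
  `m(c) := m'(c)` if `m'(c) < M(c)` else `⊤` ([J] §3.1 item 5), and — the mathematical content of this
  file — `m_∞` CONSTRUCTED and `hmInf ∧ hK` PROVED from the Literature fact
  `McCallum1991.prop52_exists_conductor_kolyvaginClass_order_eq` (McCallum 1991 Prop. 5.2 = Kolyvagin's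
  redefinition, typed by seat `bsd-jet-lit-ty`, p477423): `m_∞ := min ⋃_r {u : some c ∈ Λ^r has a derived
  point of exact depth u < M(c)}` (McCallum's `M_r`, minimised over `r ≥ 0`; the `r = 0` branch is `c = 1`,
  `M(1) = ∞`, so NO monotonicity `M_{r+1} ≤ M_r` and NO Mordell–Weil finiteness is needed: if the union
  is empty the target conductor is already divisible to depth `M(c) ≥ s`). What remains as the ONE
  hypothesis `H` is exactly «[J] Prop. 6.4 and [J] Thm. 6.3 hold for THIS `(Λ, M, m', m, m_∞)`» — i.e. the
  Selmer-level inputs S1–S8 of sheet `HOME/sheets/PV2-J6-KERNEL.md` §2 instantiated (abstract Thm. 6.3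
  is `Section6.tamagawaExponent_le_mInfty_of_minimalCoreVertex`); S9 (McCallum 5.2) and the `m_∞`
  bookkeeping are DISCHARGED here.
* `jetchevDivisibilityCarrierMult_of_prop52_of_section6`, `…CarrierNe…`, `…CarrierAdd…` — the three
  reading binders K3 ∕ K1 ∕ K4 follow from McCallum Prop. 5.2 + `H` at `t := ord_p c_p` ∕ `ord_p c_q`
  (bookkeeping on top of the first theorem; the binders' extra hypotheses — reduction type at `p`,
  `q ∣ N` — are simply available to `H`).

So the (J∥)/(J∣N) kernel line now reads, in the kernel: K1 ∧ K3 ∧ K4 ⟸ McCallum 5.2 (typed fact) +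
Prop. 6.4 + Thm. 6.3 for the row objects. No hypothesis anywhere mentions the reduction of `E` at `p`
except through `t`. CONDITIONAL on nothing new; 0 classes move.

References: [cite: Jetchev2008, §3.1 item 5, Prop. 6.4, Thm. 6.3 and Proof of Thm. 1.4 (pp. 817, 825)]
[cite: McCallumLMS1991, §5 Prop. 5.2 (p. 304)] [cite: WZhang2014, Notations (xii)].
-/

set_option autoImplicit false

noncomputable section

open scoped Classical

open WeierstrassCurve Literature.NumberTheory.EllipticCurves
  Literature.NumberTheory.EllipticCurves.ModularForms

namespace Summit.BirchSwinnertonDyer.Rank1Residual.JET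

/-- `p^u`-divisibility of a point is downward closed in `u`. Elementary. -/
theorem exists_pow_smul_eq_of_le {A : Type*} [AddCommGroup A] (p : ℕ) {u v : ℕ} (huv : v ≤ u)
    {P : A} (h : ∃ Q : A, ((p ^ u : ℕ) : ℤ) • Q = P) : ∃ Q : A, ((p ^ v : ℕ) : ℤ) • Q = P := by
  obtain ⟨Q, hQ⟩ := h
  refine ⟨((p ^ (u - v) : ℕ) : ℤ) • Q, ?_⟩
  rw [smul_smul, ← Nat.cast_mul, ← pow_add, Nat.add_sub_cancel' huv, hQ]

/-- **The bridge.** For `W/ℚ` (globally minimal, non-CM), `K` Heegner with `d_K ∉ {−3,−4}`, `p ≠ 2` with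
the `p`-adic tower, a frame `(Dt, β, ι)` with `y_K = d₁.derivedPoint` of infinite order, and a number
`t`: IF [J] Prop. 6.4 and Thm. 6.3 hold for the row objects — hypothesis `H`, quantified over every
depth function `mdiv` with `(u : ℕ∞) ≤ mdiv c ↔` «every derived point of conductor `c` is
`p^u`-divisible», `m c = mdiv c` if `mdiv c < M(c) := Zhang2014.levelIndex` else `⊤`, and every `mInf`
satisfying `mInf ≤ m c` and Kolyvagin's redefinition (these two are PROVED below from McCallum 1991
Prop. 5.2, `h52`) — THEN every derived point `P_n` with `n` a square-free product of Kolyvagin primes of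
index `≥ s`, `s ≤ t`, is `p^s`-divisible in `E(K[n])`. Proof: if `s ≤ m'(n)` done; else `m'(n) < M(n)`
so McCallum's set `⋃_r M_r`-candidates is non-empty, `m_∞ :=` its minimum, `hmInf` by minimality, `hK`
by `c = 1` (`r = 0`) or by Prop. 5.2 via `McCallum1991.exists_conductor_levelIndex_ge_exactDepth_of_prop52`
(`r ≥ 1`), then `Section6.depth_le_mdiv_of_coreVertices`.
[cite: Jetchev2008, Proof of Thm. 1.4 (p. 825), §3.1 item 5 (p. 817)] [cite: McCallumLMS1991, §5 Prop. 5.2 (p. 304)] -/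
theorem derivedPoint_divisible_of_prop52_of_section6
    (h52 : McCallum1991.prop52_exists_conductor_kolyvaginClass_order_eq)
    (W : WeierstrassCurve ℚ) [W.IsElliptic] [W.IsGloballyMinimal] [NeZero (W.conductorNorm ℤ)]
    (hcm : ¬ W.HasCM) (K : Type) [Field K] [NumberField K] (hK : IsImaginaryQuadratic K)
    (hD3 : NumberField.discr K ≠ -3) (hD4 : NumberField.discr K ≠ -4)
    (hH : SatisfiesHeegnerHypothesis (W.conductorNorm ℤ) K)
    (p : ℕ) [Fact p.Prime] (hp2 : p ≠ 2) (htower : ∀ n : ℕ, W.HasSurjectiveModNGaloisRep (p ^ n : ℕ))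
    (Dt : ModularParametrizationData W (W.conductorNorm ℤ)) (β : ℤ) (ι : K →+* ℂ)
    (d₁ : KolyvaginHeegnerData Dt β ι 1) (hy : ¬ IsOfFinAddOrder d₁.derivedPoint) (t : ℕ)
    (H : ∀ (mdiv m : {c : ℕ // Squarefree c ∧ ∀ ℓ ∈ c.primeFactors,
          Zhang2014.IsKolyvaginPrime (W.conductorNorm ℤ) W K p ℓ} → ℕ∞),
      (∀ c (u : ℕ), (u : ℕ∞) ≤ mdiv c ↔ ∀ d : KolyvaginHeegnerData Dt β ι c.1,
        ∃ Q : (W.baseChange (ringClassField K ι c.1)).toAffine.Point,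
          ((p ^ u : ℕ) : ℤ) • Q = d.derivedPoint) →
      (∀ c, m c = if mdiv c < Zhang2014.levelIndex W p c.1 then mdiv c else ⊤) →
      ∀ mInf : ℕ, (∀ c, (mInf : ℕ∞) ≤ m c) →
        (∀ m' : ℕ, ∃ c, (m' : ℕ∞) ≤ Zhang2014.levelIndex W p c.1 ∧ m c = mInf) →
      ∃ Core : ℕ → {c : ℕ // Squarefree c ∧ ∀ ℓ ∈ c.primeFactors,
          Zhang2014.IsKolyvaginPrime (W.conductorNorm ℤ) W K p ℓ} → Prop,
        (∀ (k : ℕ) c, m c + k ≤ Zhang2014.levelIndex W p c.1 →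
          ∃ c', Core k c' ∧ (k : ℕ∞) + m c ≤ Zhang2014.levelIndex W p c'.1 ∧ m c' ≤ m c) ∧
        (∀ (k : ℕ) c, Core k c → m c = mInf → (k : ℕ∞) + mInf ≤ Zhang2014.levelIndex W p c.1 →
          t < k → mInf < k → t ≤ mInf))
    (s : ℕ) (hs : s ≤ t) (n : ℕ) (d : KolyvaginHeegnerData Dt β ι n) (hn : Squarefree n)
    (hℓ : ∀ ℓ ∈ n.primeFactors, Zhang2014.IsKolyvaginPrime (W.conductorNorm ℤ) W K p ℓ ∧
      s ≤ Zhang2014.kolyvaginIndex W p ℓ) :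
    ∃ Q : (W.baseChange (ringClassField K ι n)).toAffine.Point,
      ((p ^ s : ℕ) : ℤ) • Q = d.derivedPoint := by
  -- the conductor type and the divisibility predicate
  set Λ := {c : ℕ // Squarefree c ∧ ∀ ℓ ∈ c.primeFactors,
    Zhang2014.IsKolyvaginPrime (W.conductorNorm ℤ) W K p ℓ} with hΛ
  let Dv : ∀ c : ℕ, ℕ → Prop := fun c u ↦ ∀ d : KolyvaginHeegnerData Dt β ι c,
    ∃ Q : (W.baseChange (ringClassField K ι c)).toAffine.Point, ((p ^ u : ℕ) : ℤ) • Q = d.derivedPoint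
  have hDv0 : ∀ c, Dv c 0 := fun c d ↦ ⟨d.derivedPoint, by simp⟩
  have hDvmono : ∀ c {u v : ℕ}, v ≤ u → Dv c u → Dv c v :=
    fun c u v huv h d ↦ exists_pow_smul_eq_of_le p huv (h d)
  -- the depth function `m'(c)` and its characterisation
  let mdivN : ℕ → ℕ∞ := fun c ↦
    if h : ∃ u, ¬ Dv c u then ((Nat.find h - 1 : ℕ) : ℕ∞) else ⊤
  have hchar : ∀ (c u : ℕ), (u : ℕ∞) ≤ mdivN c ↔ Dv c u := by
    intro c u
    by_cases h : ∃ u, ¬ Dv c u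
    · have hfind0 : 0 < Nat.find h := by
        rw [Nat.find_pos]
        exact fun h0 ↦ h0 (hDv0 c)
      simp only [mdivN, dif_pos h, ENat.coe_le_coe]
      constructor
      · intro hu
        have hlt : u < Nat.find h := by omega
        have := (Nat.lt_find_iff h u).mp hlt u le_rfl
        simpa using this
      · intro hu
        have hlt : u < Nat.find h := by
          rw [Nat.lt_find_iff]
          intro v hv hnv
          exact hnv (hDvmono c hv hu)
        omega
    · simp only [mdivN, dif_neg h, le_top, true_iff]
      exact not_not.mp (not_exists.mp h u)
  -- exact-depth witnesses at a finite depth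
  have hexact : ∀ (c u : ℕ), mdivN c = u →
      Dv c u ∧ ∃ d : KolyvaginHeegnerData Dt β ι c,
        (∃ Q : (W.baseChange (ringClassField K ι c)).toAffine.Point,
          ((p ^ u : ℕ) : ℤ) • Q = d.derivedPoint) ∧
        ¬ ∃ Q : (W.baseChange (ringClassField K ι c)).toAffine.Point,
          ((p ^ (u + 1) : ℕ) : ℤ) • Q = d.derivedPoint := by
    intro c u hcu
    have hu : Dv c u := (hchar c u).mp (by rw [hcu])
    have hu1 : ¬ Dv c (u + 1) := by
      rw [← hchar c (u + 1), hcu, ENat.coe_le_coe]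
      omega
    obtain ⟨d, hd⟩ := not_forall.mp hu1
    exact ⟨hu, d, hu d, hd⟩
  -- the functions on `Λ`
  let M : Λ → ℕ∞ := fun c ↦ Zhang2014.levelIndex W p c.1
  let mdiv : Λ → ℕ∞ := fun c ↦ mdivN c.1
  let m : Λ → ℕ∞ := fun c ↦ if mdiv c < M c then mdiv c else ⊤
  have hm : ∀ c, mdiv c < M c → m c ≤ mdiv c := fun c h ↦ by
    simp only [m, if_pos h]
    exact le_rfl
  -- the target conductor as an element of `Λ`, and `s ≤ M(n)`
  let cn : Λ := ⟨n, hn, fun ℓ h ↦ (hℓ ℓ h).1⟩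
  have hsM : (s : ℕ∞) ≤ M cn :=
    Zhang2014.natCast_le_levelIndex_iff.mpr fun ℓ h ↦ (hℓ ℓ h).2
  -- it suffices to bound the depth of conductor `n`
  suffices hgoal : (s : ℕ∞) ≤ mdiv cn from ((hchar n s).mp hgoal) d
  by_contra hlt
  rw [not_le] at hlt
  -- `m'(n)` is finite, `= u₀ < s ≤ M(n)`: McCallum's candidate set is non-empty
  obtain ⟨u₀, hu₀⟩ := ENat.ne_top_iff_exists.mp (ne_top_of_lt hlt)
  -- McCallum's set `⋃_r {u | ∃ c ∈ Λ^r, d : exact depth u, u + 1 ≤ M(ℓ) ∀ ℓ ∣ c}`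
  let T : ℕ → Prop := fun u ↦ ∃ (c : ℕ) (d : KolyvaginHeegnerData Dt β ι c), Squarefree c ∧
      (∀ ℓ ∈ c.primeFactors, Zhang2014.IsKolyvaginPrime (W.conductorNorm ℤ) W K p ℓ ∧
        u + 1 ≤ Zhang2014.kolyvaginIndex W p ℓ) ∧
      (∃ Q : (W.baseChange (ringClassField K ι c)).toAffine.Point,
        ((p ^ u : ℕ) : ℤ) • Q = d.derivedPoint) ∧
      ¬ ∃ Q : (W.baseChange (ringClassField K ι c)).toAffine.Point,
        ((p ^ (u + 1) : ℕ) : ℤ) • Q = d.derivedPoint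
  -- membership of every `c ∈ Λ` with `m'(c) < M(c)`
  have hTmem : ∀ (c : Λ) (u : ℕ), mdiv c = u → mdiv c < M c → T u := by
    intro c u hcu hcM
    obtain ⟨-, d', hd', hnd'⟩ := hexact c.1 u hcu
    have hu1 : ((u + 1 : ℕ) : ℕ∞) ≤ M c := by
      rw [hcu] at hcM
      have : (u : ℕ∞) + 1 ≤ M c := (ENat.add_one_le_iff (ENat.coe_ne_top u)).mpr hcM
      exact_mod_cast this
    exact ⟨c.1, d', c.2.1, fun ℓ h ↦ ⟨c.2.2 ℓ h, (Zhang2014.natCast_le_levelIndex_iff.mp hu1) ℓ h⟩,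
      hd', hnd'⟩
  have hT : ∃ u, T u := ⟨u₀, hTmem cn u₀ hu₀.symm (hlt.trans_le hsM)⟩
  -- `m_∞ := min T`
  set mInf : ℕ := Nat.find hT with hmInfdef
  have hmInfT : T mInf := Nat.find_spec hT
  have hmInfmin : ∀ u, T u → mInf ≤ u := fun u hu ↦ Nat.find_min' hT hu
  -- `hmInf : m_∞ ≤ m(c)`
  have hmInf : ∀ c, (mInf : ℕ∞) ≤ m c := by
    intro c
    by_cases hcM : mdiv c < M c
    · obtain ⟨u, hu⟩ := ENat.ne_top_iff_exists.mp (ne_top_of_lt hcM)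
      have : (mInf : ℕ∞) ≤ mdiv c := by
        rw [← hu, ENat.coe_le_coe]
        exact hmInfmin u (hTmem c u hu.symm hcM)
      simp only [m, if_pos hcM]
      exact this
    · simp only [m, if_neg hcM]
      exact le_top
  -- from an exact-depth-`mInf` datum with `mInf + 1 ≤ M(c)`: `m(c) = m_∞`
  have hmeq : ∀ (c : Λ) (d' : KolyvaginHeegnerData Dt β ι c.1),
      ((mInf + 1 : ℕ) : ℕ∞) ≤ M c →
      (¬ ∃ Q : (W.baseChange (ringClassField K ι c.1)).toAffine.Point,
        ((p ^ (mInf + 1) : ℕ) : ℤ) • Q = d'.derivedPoint) → m c = mInf := by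
    intro c d' hMc hnd'
    -- `m'(c) ≤ mInf`
    have hle : mdiv c ≤ mInf := by
      have h1 : ¬ ((mInf + 1 : ℕ) : ℕ∞) ≤ mdiv c := by
        rw [hchar c.1 (mInf + 1)]
        exact fun h ↦ hnd' (h d')
      rw [not_le] at h1
      have h2 : mdiv c < (mInf : ℕ∞) + 1 := by exact_mod_cast h1
      exact (ENat.lt_add_one_iff (ENat.coe_ne_top mInf)).mp h2
    have hcM : mdiv c < M c := by
      refine lt_of_le_of_lt hle ?_
      have : (mInf : ℕ∞) < (mInf : ℕ∞) + 1 :=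
        ENat.lt_add_one_iff (ENat.coe_ne_top mInf) |>.mpr le_rfl
      exact this.trans_le (by exact_mod_cast hMc)
    have hge : (mInf : ℕ∞) ≤ mdiv c := by
      have := hmInf c
      simp only [m, if_pos hcM] at this
      exact this
    simp only [m, if_pos hcM]
    exact le_antisymm hle hge
  -- `hK : ∀ m', ∃ c, m' ≤ M(c) ∧ m(c) = m_∞` — by `c = 1` (`r = 0`) or McCallum Prop. 5.2 (`r ≥ 1`)
  have hKoly : ∀ m' : ℕ, ∃ c, (m' : ℕ∞) ≤ M c ∧ m c = mInf := by
    intro m'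
    obtain ⟨c₀, d₀, hsq₀, hℓ₀, hd₀, hnd₀⟩ := hmInfT
    by_cases hr : c₀.primeFactors.card = 0
    · -- `r = 0`: `c₀ = 1`, `M(1) = ⊤`
      have hc₀ : c₀ = 1 := by
        rcases Nat.primeFactors_eq_empty.mp (Finset.card_eq_zero.mp hr) with h | h
        · exact absurd h hsq₀.ne_zero
        · exact h
      subst hc₀
      let c1 : Λ := ⟨1, squarefree_one, by simp⟩
      have hM1 : M c1 = ⊤ := Zhang2014.levelIndex_one
      refine ⟨c1, by simp [hM1], hmeq c1 d₀ (by simp [hM1]) hnd₀⟩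
    · -- `r ≥ 1`: McCallum Prop. 5.2 at `M := max m' (m_∞ + 1)`
      have hr0 : 0 < c₀.primeFactors.card := Nat.pos_of_ne_zero hr
      have hleast : IsLeast {u : ℕ | ∃ (c : ℕ) (d : KolyvaginHeegnerData Dt β ι c), Squarefree c ∧
          c.primeFactors.card = c₀.primeFactors.card ∧
          (∀ ℓ ∈ c.primeFactors, Zhang2014.IsKolyvaginPrime (W.conductorNorm ℤ) W K p ℓ ∧
            u + 1 ≤ Zhang2014.kolyvaginIndex W p ℓ) ∧
          (∃ Q : (W.baseChange (ringClassField K ι c)).toAffine.Point,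
            ((p ^ u : ℕ) : ℤ) • Q = d.derivedPoint) ∧
          ¬ ∃ Q : (W.baseChange (ringClassField K ι c)).toAffine.Point,
            ((p ^ (u + 1) : ℕ) : ℤ) • Q = d.derivedPoint} mInf :=
        ⟨⟨c₀, d₀, hsq₀, rfl, hℓ₀, hd₀, hnd₀⟩,
          fun u ⟨c, d', hsq, _, hℓ', hd', hnd'⟩ ↦ hmInfmin u ⟨c, d', hsq, hℓ', hd', hnd'⟩⟩
      obtain ⟨c, d', hsq, -, hℓ', hMc, -, hnd'⟩ :=
        McCallum1991.exists_conductor_levelIndex_ge_exactDepth_of_prop52 h52 W hcm K hK hD3 hD4 hH p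
          hp2 htower Dt β ι d₁ hy _ hr0 mInf hleast (max m' (mInf + 1))
      let cc : Λ := ⟨c, hsq, hℓ'⟩
      have hMc' : ((max m' (mInf + 1) : ℕ) : ℕ∞) ≤ M cc := hMc
      refine ⟨cc, le_trans (by exact_mod_cast le_max_left m' (mInf + 1)) hMc',
        hmeq cc d' (le_trans (by exact_mod_cast le_max_right m' (mInf + 1)) hMc') hnd'⟩
  -- Prop. 6.4 and Thm. 6.3 for these data
  obtain ⟨Core, h64, h63⟩ := H mdiv m (fun c u ↦ hchar c.1 u) (fun c ↦ rfl) mInf hmInf hKoly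
  -- §6 abstract end form
  have := Section6.depth_le_mdiv_of_coreVertices M mdiv m hm Core t mInf hmInf hKoly h64 h63 s hs
    cn hsM
  exact absurd this (not_le.mpr hlt)

/-- **K3 (bucket B-mult) from McCallum 1991 Prop. 5.2 + «Prop. 6.4 and Thm. 6.3 for the row objects»**:
the reading binder `JetchevDivisibilityCarrierMult` follows from the Literature fact
`McCallum1991.prop52_exists_conductor_kolyvaginClass_order_eq` and the hypothesis `H` of
`derivedPoint_divisible_of_prop52_of_section6` at `t := ord_p c_p(E)` for every multiplicative `p ∥ N`
with the tower (the binder's own hypotheses are handed to `H`). Bookkeeping over the bridge.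
[cite: Jetchev2008, Thm. 1.4 (p. 812) and its proof (p. 825)] [cite: McCallumLMS1991, §5 Prop. 5.2 (p. 304)] -/
theorem jetchevDivisibilityCarrierMult_of_prop52_of_section6
    (h52 : McCallum1991.prop52_exists_conductor_kolyvaginClass_order_eq)
    (H : ∀ (W : WeierstrassCurve ℚ) [W.IsElliptic] [W.IsGloballyMinimal] [NeZero (W.conductorNorm ℤ)],
      ¬ W.HasCM → ∀ (K : Type) [Field K] [NumberField K], IsImaginaryQuadratic K →
      NumberField.discr K ≠ -3 → NumberField.discr K ≠ -4 →
      SatisfiesHeegnerHypothesis (W.conductorNorm ℤ) K →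
      ∀ (p : ℕ) [Fact p.Prime], p ≠ 2 → W.HasMultiplicativeReductionAtPrime p →
      (∀ n : ℕ, W.HasSurjectiveModNGaloisRep (p ^ n : ℕ)) →
      ∀ (Dt : ModularParametrizationData W (W.conductorNorm ℤ)) (β : ℤ) (ι : K →+* ℂ)
        (d₁ : KolyvaginHeegnerData Dt β ι 1), ¬ IsOfFinAddOrder d₁.derivedPoint →
      ∀ (mdiv m : {c : ℕ // Squarefree c ∧ ∀ ℓ ∈ c.primeFactors,
          Zhang2014.IsKolyvaginPrime (W.conductorNorm ℤ) W K p ℓ} → ℕ∞),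
      (∀ c (u : ℕ), (u : ℕ∞) ≤ mdiv c ↔ ∀ d : KolyvaginHeegnerData Dt β ι c.1,
        ∃ Q : (W.baseChange (ringClassField K ι c.1)).toAffine.Point,
          ((p ^ u : ℕ) : ℤ) • Q = d.derivedPoint) →
      (∀ c, m c = if mdiv c < Zhang2014.levelIndex W p c.1 then mdiv c else ⊤) →
      ∀ mInf : ℕ, (∀ c, (mInf : ℕ∞) ≤ m c) →
        (∀ m' : ℕ, ∃ c, (m' : ℕ∞) ≤ Zhang2014.levelIndex W p c.1 ∧ m c = mInf) →
      ∃ Core : ℕ → {c : ℕ // Squarefree c ∧ ∀ ℓ ∈ c.primeFactors,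
          Zhang2014.IsKolyvaginPrime (W.conductorNorm ℤ) W K p ℓ} → Prop,
        (∀ (k : ℕ) c, m c + k ≤ Zhang2014.levelIndex W p c.1 →
          ∃ c', Core k c' ∧ (k : ℕ∞) + m c ≤ Zhang2014.levelIndex W p c'.1 ∧ m c' ≤ m c) ∧
        (∀ (k : ℕ) c, Core k c → m c = mInf → (k : ℕ∞) + mInf ≤ Zhang2014.levelIndex W p c.1 →
          padicValNat p ((W.baseChange ℚ_[p]).localTamagawaNumber ℤ_[p]) < k → mInf < k →
          padicValNat p ((W.baseChange ℚ_[p]).localTamagawaNumber ℤ_[p]) ≤ mInf)) :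
    JetchevDivisibilityCarrierMult := by
  intro W _ _ _ hcm K _ _ hK hD3 hD4 hH p _ hp2 hmult htower Dt β ι d₁ hy s hs n d hn hℓ
  exact derivedPoint_divisible_of_prop52_of_section6 h52 W hcm K hK hD3 hD4 hH p hp2 htower Dt β ι d₁
    hy _ (H W hcm K hK hD3 hD4 hH p hp2 hmult htower Dt β ι d₁ hy) s hs n d hn hℓ

/-- **K1 (bucket A, carrier `q ≠ p`) from McCallum 1991 Prop. 5.2 + «Prop. 6.4 and Thm. 6.3 for the row
objects»** at `t := ord_p c_q(E)`; the carrier `q ∣ N`, `q ≠ p` is handed to `H`. Bookkeeping over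
the bridge. [cite: Jetchev2008, Thm. 1.4 (p. 812) and its proof (p. 825)] [cite: McCallumLMS1991, §5 Prop. 5.2 (p. 304)] -/
theorem jetchevDivisibilityCarrierNe_of_prop52_of_section6
    (h52 : McCallum1991.prop52_exists_conductor_kolyvaginClass_order_eq)
    (H : ∀ (W : WeierstrassCurve ℚ) [W.IsElliptic] [W.IsGloballyMinimal] [NeZero (W.conductorNorm ℤ)],
      ¬ W.HasCM → ∀ (K : Type) [Field K] [NumberField K], IsImaginaryQuadratic K →
      NumberField.discr K ≠ -3 → NumberField.discr K ≠ -4 →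
      SatisfiesHeegnerHypothesis (W.conductorNorm ℤ) K →
      ∀ (p : ℕ) [Fact p.Prime], p ≠ 2 → (∀ n : ℕ, W.HasSurjectiveModNGaloisRep (p ^ n : ℕ)) →
      ∀ (Dt : ModularParametrizationData W (W.conductorNorm ℤ)) (β : ℤ) (ι : K →+* ℂ)
        (d₁ : KolyvaginHeegnerData Dt β ι 1), ¬ IsOfFinAddOrder d₁.derivedPoint →
      ∀ (q : ℕ) [Fact q.Prime], q ∣ W.conductorNorm ℤ → q ≠ p →
      ∀ (mdiv m : {c : ℕ // Squarefree c ∧ ∀ ℓ ∈ c.primeFactors,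
          Zhang2014.IsKolyvaginPrime (W.conductorNorm ℤ) W K p ℓ} → ℕ∞),
      (∀ c (u : ℕ), (u : ℕ∞) ≤ mdiv c ↔ ∀ d : KolyvaginHeegnerData Dt β ι c.1,
        ∃ Q : (W.baseChange (ringClassField K ι c.1)).toAffine.Point,
          ((p ^ u : ℕ) : ℤ) • Q = d.derivedPoint) →
      (∀ c, m c = if mdiv c < Zhang2014.levelIndex W p c.1 then mdiv c else ⊤) →
      ∀ mInf : ℕ, (∀ c, (mInf : ℕ∞) ≤ m c) →
        (∀ m' : ℕ, ∃ c, (m' : ℕ∞) ≤ Zhang2014.levelIndex W p c.1 ∧ m c = mInf) →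
      ∃ Core : ℕ → {c : ℕ // Squarefree c ∧ ∀ ℓ ∈ c.primeFactors,
          Zhang2014.IsKolyvaginPrime (W.conductorNorm ℤ) W K p ℓ} → Prop,
        (∀ (k : ℕ) c, m c + k ≤ Zhang2014.levelIndex W p c.1 →
          ∃ c', Core k c' ∧ (k : ℕ∞) + m c ≤ Zhang2014.levelIndex W p c'.1 ∧ m c' ≤ m c) ∧
        (∀ (k : ℕ) c, Core k c → m c = mInf → (k : ℕ∞) + mInf ≤ Zhang2014.levelIndex W p c.1 →
          padicValNat p ((W.baseChange ℚ_[q]).localTamagawaNumber ℤ_[q]) < k → mInf < k →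
          padicValNat p ((W.baseChange ℚ_[q]).localTamagawaNumber ℤ_[q]) ≤ mInf)) :
    JetchevDivisibilityCarrierNe := by
  intro W _ _ _ hcm K _ _ hK hD3 hD4 hH p _ hp2 htower Dt β ι d₁ hy q _ hqN hqp s hs n d hn hℓ
  exact derivedPoint_divisible_of_prop52_of_section6 h52 W hcm K hK hD3 hD4 hH p hp2 htower Dt β ι d₁
    hy _ (H W hcm K hK hD3 hD4 hH p hp2 htower Dt β ι d₁ hy q hqN hqp) s hs n d hn hℓ

/-- **K4 (bucket B-add, carrier `p` additive) from McCallum 1991 Prop. 5.2 + «Prop. 6.4 and Thm. 6.3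
for the row objects»** at `t := ord_p c_p(E)`; the reduction hypotheses at `p` are handed to `H`.
Bookkeeping over the bridge. [cite: Jetchev2008, Thm. 1.4 (p. 812) and its proof (p. 825)]
[cite: McCallumLMS1991, §5 Prop. 5.2 (p. 304)] -/
theorem jetchevDivisibilityCarrierAdd_of_prop52_of_section6
    (h52 : McCallum1991.prop52_exists_conductor_kolyvaginClass_order_eq)
    (H : ∀ (W : WeierstrassCurve ℚ) [W.IsElliptic] [W.IsGloballyMinimal] [NeZero (W.conductorNorm ℤ)],
      ¬ W.HasCM → ∀ (K : Type) [Field K] [NumberField K], IsImaginaryQuadratic K →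
      NumberField.discr K ≠ -3 → NumberField.discr K ≠ -4 →
      SatisfiesHeegnerHypothesis (W.conductorNorm ℤ) K →
      ∀ (p : ℕ) [Fact p.Prime], p ≠ 2 →
      ¬ W.HasGoodReductionAtPrime p → ¬ W.HasMultiplicativeReductionAtPrime p →
      (∀ n : ℕ, W.HasSurjectiveModNGaloisRep (p ^ n : ℕ)) →
      ∀ (Dt : ModularParametrizationData W (W.conductorNorm ℤ)) (β : ℤ) (ι : K →+* ℂ)
        (d₁ : KolyvaginHeegnerData Dt β ι 1), ¬ IsOfFinAddOrder d₁.derivedPoint →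
      ∀ (mdiv m : {c : ℕ // Squarefree c ∧ ∀ ℓ ∈ c.primeFactors,
          Zhang2014.IsKolyvaginPrime (W.conductorNorm ℤ) W K p ℓ} → ℕ∞),
      (∀ c (u : ℕ), (u : ℕ∞) ≤ mdiv c ↔ ∀ d : KolyvaginHeegnerData Dt β ι c.1,
        ∃ Q : (W.baseChange (ringClassField K ι c.1)).toAffine.Point,
          ((p ^ u : ℕ) : ℤ) • Q = d.derivedPoint) →
      (∀ c, m c = if mdiv c < Zhang2014.levelIndex W p c.1 then mdiv c else ⊤) →
      ∀ mInf : ℕ, (∀ c, (mInf : ℕ∞) ≤ m c) →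
        (∀ m' : ℕ, ∃ c, (m' : ℕ∞) ≤ Zhang2014.levelIndex W p c.1 ∧ m c = mInf) →
      ∃ Core : ℕ → {c : ℕ // Squarefree c ∧ ∀ ℓ ∈ c.primeFactors,
          Zhang2014.IsKolyvaginPrime (W.conductorNorm ℤ) W K p ℓ} → Prop,
        (∀ (k : ℕ) c, m c + k ≤ Zhang2014.levelIndex W p c.1 →
          ∃ c', Core k c' ∧ (k : ℕ∞) + m c ≤ Zhang2014.levelIndex W p c'.1 ∧ m c' ≤ m c) ∧
        (∀ (k : ℕ) c, Core k c → m c = mInf → (k : ℕ∞) + mInf ≤ Zhang2014.levelIndex W p c.1 →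
          padicValNat p ((W.baseChange ℚ_[p]).localTamagawaNumber ℤ_[p]) < k → mInf < k →
          padicValNat p ((W.baseChange ℚ_[p]).localTamagawaNumber ℤ_[p]) ≤ mInf)) :
    JetchevDivisibilityCarrierAdd := by
  intro W _ _ _ hcm K _ _ hK hD3 hD4 hH p _ hp2 hgood hmult htower Dt β ι d₁ hy s hs n d hn hℓ
  exact derivedPoint_divisible_of_prop52_of_section6 h52 W hcm K hK hD3 hD4 hH p hp2 htower Dt β ι d₁
    hy _ (H W hcm K hK hD3 hD4 hH p hp2 hgood hmult htower Dt β ι d₁ hy) s hs n d hn hℓ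

end Summit.BirchSwinnertonDyer.Rank1Residual.JET

end
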